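import Summits.QuantumFields.BalabanUV.T4Continuum.Support.NE7HdecompOfNL0
import HarnessLib

/-!
# NE7HdecompOfNL0Generic — PORT MAP P2.6a: `hdecomp♭` DISCHARGED AT `d = 4` FOR EVERY BLOCK SIZE `L ≥ 2` AND EVERY `U(n)` — `NE7HdecompOfNL0.hdecomp_of_nl0` (gen 104, `L = 2`) RE-ISSUED
# GENERICALLY: the (R1″) slice representative (`NE7SliceRepresentativeNL0.slice_representative_nl0`, any `d, L`), [B8]'s two direct letters (`NE7SliceDirectLettersNL0`, any `L`), the
# frame-free right inverse and its three `R₀`-letters with row NE7b's frame masses (`NE7FrameFreeRightInverseLetters`, `NE7RightInverseFrameLetters`, any `L`) and the generic junction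
# `NE7DecompOfLettersGeneric.decomp_of_letters` — every core was already `L`-generic; only the k-free letters `K₁, q₁, C_Θ₁, C_Θ₂` carried `L = 2` numerals

Cell `pub-balaban`, rung (B)+1 sub-cell t4, lineage `b2b-balaban-t4-ne7-p1`, generation 109 (CRUX PROVER NE7 #1 = OWNER of BINDER row NE7).  Memo
`t4/b2b-balaban-t4-ne7-p1-g109/ROAD-G109.md` §3 (PORT MAP item P2.6a).  Letters at block size `L`: `K₁ = C1cov 4·L²·√(4(4L+1)⁴)`, `q₁ = 64(C1cov 4·L²·4(4L+1)⁴)·L²`,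
`C_Θ₂ = 2⁴(frameC 4 L·liftC 4)²·#l1Ball(frameRad 4 L)`, `C_Θ₁ = 2⁴·frameC 4 L·liftC 4·#l1Ball(frameRad 4 L)`; `ν_c = √(A₁+A₂)·32K₁C_S`, `κ_c = A₃q₁` as in the record.
WHAT ([folklore]; 0 def, 0 sorry).  **`hdecomp_of_nl0_generic`**: there are k-free `ε₂ > 0`, `C_S > 0`, `ν_c, κ_c ≥ 0` (depending on `L`, `card n`) such that for every `0 < ε ≤ ε₂`, every `β`,
`N`, datum `D`, level `k`, every tangent-critical admissible `U_s ∈ admissible (sfClass 4 L N ε) L (k+1) D` and admissible `U′`, and every residual near-representative `u₀` (unitary,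
`(N·M)`-periodic, corner-trivial, `10³⁴·M·(ε∕M²)`-close, `M = L^{k+1}`), the body of `hdecomp♭` over `𝒯_E = energyBlockLandauW L N (k+1) U_s` holds with `α·M ≤ C_S·ε`, `ν ≤ ν_c·ε`,
`κ ≤ κ_c·ε`.
HONEST FRAMING (page 1): composition of landed kernel theorems of this lineage (gens 100–104) and row NE7b's frame masses; [B7]∕[B8] AS TYPED; nothing of Bałaban's asserted; NE7 NOT proved;
spine 0∕9; finite T⁴ rung (B)+1 — NOT infinite volume, NOT mass gap, NOT BetaPertH, NOT Clay (continuum YM on T⁴ ⇐ BetaPertH ∧ nine spine estimates).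
-/

set_option autoImplicit false

open scoped BigOperators Matrix Matrix.Norms.L2Operator
open NormedSpace Finset Set

namespace Summit.QuantumFields.BalabanUV.T4Continuum.NE7HdecompOfNL0Generic

open Literature.MathematicalPhysics.QuantumFieldTheory.Balaban1983to89
open B7Prop1Explicit B7Prop2Explicit B7Prop3Flat MatrixLog
open B7Eq92Concrete (vcov)
open T4AveragingDeficitWall (IsUnitaryCfg IsSkewDir SmallField vary curl curlSq dirSq dirL1)
open T4AveragingDeficitWallBoundary (IsPeriodicCfg periodBox)
open AveragingDeficitPeriodicCounting (IsPeriodicDir)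
open AveragingDeficitTwoLevelPrep (prop1Radius)
open AveragingDeficitMultiLevelPrep (LevelSmall tower TangentIter cavgIter)
open AveragingDeficitMultiLevelBridge (cavgIter_eq_avgIter)
open MinimalActionLevels (perWin)
open MinimalActionSandwich (admissible)
open MinimalActionRate (sfClass)
open ReplicationRightInverseBound (radSum)
open BlockAverageVaryHolo (nbRad)
open NE3HessForm (dAction)
open NE3EnergyShapes (IsUnitarySite IsPeriodicSite)
open NE3EnergyWeightedShapes (energyNormW energyNormW_nonneg)
open NE3QbarIterCovLiftPrep (cruxC liftC liftC_nonneg)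
open NE3RightInverseSupLetters (frameC)
open NE3RightInverseSolveLetters (thetaLoc thetaLoc_nonneg l1Ball)
open NE3FrameGenLocal (frameRad)
open NE3RightInverseL2Letter (l2C l2C_nonneg)
open NE3HatInvCurlLetters (curl2C curl1C curl2C_nonneg curl1C_nonneg)
open NE3CovariantLineSumsError (Csup)
open ShellMeasureAverageProp4General (C1cov C1cov_pos)
open NE3FramePotBoundW (tower_eq_pow_mul)
open NE3TangentCovariantTower (framePotW)
open NE3.PairLandauB8Avg (relPert)
open NE7MeanZeroGaugeSliceW (energyBlockLandauW)
open SpreadLift (loopRad)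
open NE7FrameFreeRightInverse (rightInvW0 frameC_nonneg)
open NE7FrameFreeRightInverseLetters (dirSq_rightInvW0_le curlSq_rightInvW0_le sum_norm_curl_rightInvW0_le)
open NE7RightInverseFrameLetters (sum_normSq_framePotW_rightInvW_le sum_norm_framePotW_rightInvW_le)
open NE7SliceIterationState (repLog cornerLog)
open NE7SliceIterationStateNL (coarseDatumNL)
open NE7SliceIterationStateFacts (repLog_skew repLog_periodic)
open NE7SliceRepresentativeNL0 (slice_representative_nl0)
open NE7SliceDirectLettersNL0 (directLetter_L1_nl0 directLetter_L2_nl0)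
open NE7DecompOfLettersGeneric (decomp_of_letters)

noncomputable section

variable {n : Type*} [Fintype n] [DecidableEq n]

set_option maxHeartbeats 800000 in
/-- **`hdecomp♭` DISCHARGED AT `d = 4`, ANY BLOCK SIZE `L ≥ 2`** (F-record `NE7HdecompOfNL0.hdecomp_of_nl0` under the PORT MAP recipe): there are k-free `ε₂ > 0`, `C_S > 0`, `ν_c, κ_c ≥ 0` such that for every `0 < ε ≤ ε₂`, every `β`, `N`, every datum `D` of the small-field class, every
level `k`, every tangent-critical admissible `U_s` and admissible `U′` over `D`, and every residual near-representative `u₀` (unitary, `(N·M)`-periodic, corner-trivial, `10³⁴·M·(ε∕M²)`-close), the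
body of `hdecomp♭` holds with `α·M ≤ C_S·ε`, `ν ≤ ν_c·ε`, `κ ≤ κ_c·ε`. [folklore] -/
theorem hdecomp_of_nl0_generic [Nonempty n] {L : ℕ} (hL : 2 ≤ L) :
    ∃ ε₂ : ℝ, 0 < ε₂ ∧ ∃ CS : ℝ, 0 < CS ∧ ∃ νc : ℝ, 0 ≤ νc ∧ ∃ κc : ℝ, 0 ≤ κc ∧ ∀ (N : ℕ) [NeZero N] (ε : ℝ), 0 < ε → ε ≤ ε₂ → ∀ (β : ℝ),
      ∀ D : Site 4 → Fin 4 → (Matrix n n ℂ)ˣ, IsUnitaryCfg D → IsPeriodicCfg D (N : ℤ) → SmallField D (4 * (Real.exp β - 1)) → ∀ (k : ℕ),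
        ∀ Us ∈ admissible (sfClass 4 L N ε) L (k + 1) D, SmallField Us ((1 / (L : ℝ) ^ 2 * ε / 2) / ((L : ℝ) ^ (k + 1)) ^ 2) →
        (∀ φ : Site 4 → Fin 4 → Matrix n n ℂ, IsSkewDir φ → IsPeriodicDir φ ((N * L ^ (k + 1) : ℕ) : ℤ) → TangentIter L k Us φ → dAction Us φ (perWin 4 (N * L ^ (k + 1))) = 0) →
        ∀ U' ∈ admissible (sfClass 4 L N ε) L (k + 1) D,
        ∀ u₀ : Site 4 → (Matrix n n ℂ)ˣ, IsUnitarySite u₀ → IsPeriodicSite u₀ ((N * L ^ (k + 1) : ℕ) : ℤ) → (∀ z : Site 4, u₀ (((L ^ (k + 1) : ℕ) : ℤ) • z) = 1) →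
          (∀ (x : Site 4) (μ : Fin 4), ‖(((Us x μ)⁻¹ * gaugeAct u₀ U' x μ : (Matrix n n ℂ)ˣ) : Matrix n n ℂ) - 1‖
            ≤ 10000000000000000000000000000000000 * (L : ℝ) ^ (k + 1) * (ε / ((L : ℝ) ^ (k + 1)) ^ 2)) →
        ∃ (u : Site 4 → (Matrix n n ℂ)ˣ) (X XT XN : Site 4 → Fin 4 → Matrix n n ℂ) (α ν κ : ℝ),
          IsUnitarySite u ∧ IsSkewDir X ∧ IsPeriodicDir X ((N * L ^ (k + 1) : ℕ) : ℤ) ∧ 0 ≤ α ∧ (∀ x μ, ‖X x μ‖ ≤ α) ∧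
          gaugeAct u U' = vary Us X 1 ∧
          X = XT + XN ∧ XT ∈ energyBlockLandauW (d := 4) (n := n) L N (k + 1) Us ∧ IsSkewDir XN ∧ 0 ≤ ν ∧
          energyNormW L (k + 1) Us XN (periodBox (d := 4) (N * L ^ (k + 1)))
            ≤ ν * energyNormW L (k + 1) Us X (periodBox (d := 4) (N * L ^ (k + 1))) ∧
          ε / ((L : ℝ) ^ (k + 1)) ^ 2 * (∑ p ∈ perWin 4 (N * L ^ (k + 1)), ‖curl Us XN p‖)
            ≤ κ * energyNormW L (k + 1) Us X (periodBox (d := 4) (N * L ^ (k + 1))) ^ 2 ∧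
          α * (L : ℝ) ^ (k + 1) ≤ CS * ε ∧ ν ≤ νc * ε ∧ κ ≤ κc * ε := by
  haveI : NeZero L := ⟨by omega⟩
  have hL1 : 1 ≤ L := by omega
  have hL0 : (0 : ℝ) < L := by exact_mod_cast (show 0 < L by omega)
  obtain ⟨ε₂, hε₂, CS, hCS, α₀, hα₀, hα1, hα2, hrep⟩ := slice_representative_nl0 (n := n) (d := 3) (by norm_num) hL (bh := 10000000000000000000000000000000000) (by norm_num)
  -- the k-free letters at `d = 4`, block size `L`
  obtain ⟨K₁, hK₁⟩ : ∃ K₁ : ℝ, K₁ = C1cov 4 * (L : ℝ) ^ 2 * Real.sqrt (((4 : ℕ) : ℝ) * (2 * (2 * (L : ℝ)) + 1) ^ 4) := ⟨_, rfl⟩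
  have hK₁0 : 0 ≤ K₁ := by rw [hK₁]; have := C1cov_pos 4; positivity
  obtain ⟨q₁, hq₁⟩ : ∃ q₁ : ℝ, q₁ = 64 * (C1cov 4 * (L : ℝ) ^ 2 * (((4 : ℕ) : ℝ) * (2 * (2 * (L : ℝ)) + 1) ^ 4)) * ((L : ℝ) ^ 4 / (L : ℝ) ^ 2) := ⟨_, rfl⟩
  have hq₁0 : 0 ≤ q₁ := by rw [hq₁]; have := C1cov_pos 4; positivity
  obtain ⟨CΘ₂, hCΘ₂⟩ : ∃ CΘ₂ : ℝ, CΘ₂ = (2 : ℝ) ^ 4 * ((frameC 4 L * liftC 4) ^ 2 * ((l1Ball (frameRad 4 L) : Finset (Site 4))).card) := ⟨_, rfl⟩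
  have hCΘ₂0 : 0 ≤ CΘ₂ := by rw [hCΘ₂]; positivity
  obtain ⟨CΘ₁, hCΘ₁⟩ : ∃ CΘ₁ : ℝ, CΘ₁ = (2 : ℝ) ^ 4 * (frameC 4 L * liftC 4 * ((l1Ball (frameRad 4 L) : Finset (Site 4))).card) := ⟨_, rfl⟩
  have hCΘ₁0 : 0 ≤ CΘ₁ := by rw [hCΘ₁]; have := liftC_nonneg 4; have := frameC_nonneg 4 L; positivity
  obtain ⟨P, hP⟩ : ∃ P : ℝ, P = (Fintype.card (T4AveragingDeficitWall.Plane 4) : ℝ) := ⟨_, rfl⟩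
  have hP0 : 0 ≤ P := by rw [hP]; positivity
  have hl2 := l2C_nonneg 4 L
  have hc2 := curl2C_nonneg 4 L
  have hc1 := curl1C_nonneg 4 L
  -- the ceilings
  obtain ⟨A₁, hA₁⟩ : ∃ A₁ : ℝ, A₁ = 4 * (2 * l2C 4 L + 2 * (16 * ((4 : ℕ) : ℝ) ^ 3 * ((64 : ℝ) ^ 4) ^ 2 * CΘ₂)) := ⟨_, rfl⟩
  obtain ⟨A₂, hA₂⟩ : ∃ A₂ : ℝ, A₂ = 4 * (2 * curl2C 4 L + 2 * (16 * P * ((64 : ℝ) ^ 4) ^ 2 * CΘ₂)) := ⟨_, rfl⟩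
  obtain ⟨A₃, hA₃⟩ : ∃ A₃ : ℝ, A₃ = 2 * curl1C 4 L + 2 * (4 * P * (64 : ℝ) ^ 4 * CΘ₁) := ⟨_, rfl⟩
  have hA₁0 : 0 ≤ A₁ := by rw [hA₁]; positivity
  have hA₂0 : 0 ≤ A₂ := by rw [hA₂]; positivity
  have hA₃0 : 0 ≤ A₃ := by rw [hA₃]; positivity
  refine ⟨ε₂, hε₂, CS, hCS, Real.sqrt (A₁ + A₂) * (32 * K₁ * CS), by positivity, A₃ * q₁, by positivity, ?_⟩
  intro N _ ε hε hεle β D _ _ _ k Us hUs _ _ U' hU' u₀ hu₀ hu₀P hpin hclose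
  have hN : 1 ≤ N := Nat.one_le_iff_ne_zero.mpr (NeZero.ne N)
  -- the pair's class data
  have hT : (tower L N (k + 1) : ℕ) = N * L ^ (k + 1) := by rw [tower_eq_pow_mul, Nat.mul_comm]
  obtain ⟨⟨hWu, hWP, hWx⟩, hWavg⟩ := hUs
  obtain ⟨⟨hU'u, hU'P, hU'x⟩, hU'avg⟩ := hU'
  have hWPt : IsPeriodicCfg Us ((tower L N (k + 1) : ℕ) : ℤ) := by rw [hT]; exact hWP
  have hU'Pt : IsPeriodicCfg U' ((tower L N (k + 1) : ℕ) : ℤ) := by rw [hT]; exact hU'P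
  have htop : cavgIter L (k + 1) U' = cavgIter L (k + 1) Us := by rw [cavgIter_eq_avgIter, cavgIter_eq_avgIter, hU'avg, hWavg]
  have hu₀Pt : IsPeriodicSite u₀ ((tower L N (k + 1) : ℕ) : ℤ) := by rw [hT]; exact hu₀P
  have hpin' : ∀ z : Site 4, u₀ ((((L : ℕ) : ℤ)) ^ (k + 1) • z) = 1 := fun z => by
    have h := hpin z; rwa [Nat.cast_pow] at h
  have hclose' : ∀ (x : Site 4) (μ : Fin 4), ‖(((Us x μ)⁻¹ * gaugeAct u₀ U' x μ : (Matrix n n ℂ)ˣ) : Matrix n n ℂ) - 1‖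
      ≤ 10000000000000000000000000000000000 * (L : ℝ) ^ (k + 1) * (ε / ((L : ℝ) ^ (k + 1)) ^ 2) := hclose
  -- (S1)-NL0: the representative and the regime facts
  obtain ⟨hsk, hsk1, hθ, hθl, hθl2, hε1, hE, h52, hexpS, hc₃S, hsmS, hKS, hS1, hS4, u, hu, huP, hgauge, hXM, hcorner, hh, ⟨hφs, hφP⟩, hslice, hv0⟩ :=
    hrep k N Us U' ε hε hεle hWu hWPt hWx hU'u hU'Pt hU'x hu₀ hu₀Pt hpin' hclose'
  -- sizes of the representative
  have hM0 : (0 : ℝ) < (L : ℝ) ^ (k + 1) := by positivity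
  have hM1 : (1 : ℝ) ≤ (L : ℝ) ^ (k + 1) := one_le_pow₀ (by exact_mod_cast hL1)
  have hx : 0 ≤ ε / ((L : ℝ) ^ (k + 1)) ^ 2 := by positivity
  have hbS : 0 ≤ CS * ε / (L : ℝ) ^ (k + 1) := by positivity
  have hsup : ∀ (y : Site 4) (κ : Fin 4), ‖repLog Us U' u y κ‖ ≤ CS * ε / (L : ℝ) ^ (k + 1) := fun y κ => by
    rw [le_div_iff₀ hM0, mul_comm]; exact hXM y κ
  have hX8 : ∀ (y : Site 4) (κ : Fin 4), ‖repLog Us U' u y κ‖ ≤ 1 / 8 := fun y κ =>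
    (hsup y κ).trans ((div_le_self (by positivity) hM1).trans (by linarith only [hS4]))
  have hXs := repLog_skew hWu U' hU'u hu hgauge hX8
  have hXP : IsPeriodicDir (repLog Us U' u) ((N * L ^ (k + 1) : ℕ) : ℤ) := by rw [← hT]; exact repLog_periodic k N U' hWPt hU'Pt huP
  -- (S2)-NL0: the two direct letters at the representative
  have hDL1 := directLetter_L1_nl0 hL k hWu hWPt hx hsk hWx hα₀ hα1 hα2 h52 hbS hexpS hc₃S hsmS hKS U' hU'u hU'Pt hx hsk hU'x htop hu huP hgauge hX8 hsup hcorner hv0 hN hS1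
  have hDL2 := directLetter_L2_nl0 hL k hWu hWPt hx hsk hWx hα₀ hα1 hα2 h52 hbS hexpS hc₃S hsmS hKS U' hU'u hU'Pt hx hsk hU'x htop hu huP hgauge hX8 hsup hcorner hv0 hN
  -- the `R₀`-letters with row NE7b's frame masses
  have hΘ₂ := sum_normSq_framePotW_rightInvW_le hL k hWu hx hsk hWx N hθ hθl hWPt hφs
  have hΘ₁ := sum_norm_framePotW_rightInvW_le hL k hWu hx hsk hWx N hθ hθl hWPt hφs
  have hR1 := dirSq_rightInvW0_le hL k hWu hx hsk hWx N hθ hE hWPt hθl hε1 hφs (by norm_num) hΘ₂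
  have hR2 := curlSq_rightInvW0_le hL k hWu hx hsk hWx N hθ hE hWPt hθl hε1 hφs hΘ₂
  have hR3 := sum_norm_curl_rightInvW0_le hL k hWu hx hsk hWx N hθ hE hWPt hθl hε1 hφs hΘ₁
  -- the radius identity and `1/(1 − θ_loc ε) ≤ 2`
  have hid : ((L : ℝ) ^ (k + 1)) ^ 2 * (ε / ((L : ℝ) ^ (k + 1)) ^ 2) = ε := by field_simp
  rw [hid] at hθl hθl2 hε1 hΘ₂ hΘ₁ hR1 hR2 hR3
  have h1θ : 1 / 2 ≤ 1 - thetaLoc 4 L * ε := by linarith only [hθl2]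
  have hinv1 : 1 / (1 - thetaLoc 4 L * ε) ≤ 2 := by rw [div_le_iff₀ (by linarith only [h1θ])]; linarith only [h1θ]
  have hinv2 : 1 / (1 - thetaLoc 4 L * ε) ^ 2 ≤ 4 := by
    rw [div_le_iff₀ (by positivity)]; nlinarith only [h1θ]
  have hinv0 : 0 ≤ 1 / (1 - thetaLoc 4 L * ε) := by positivity
  -- constants of the three letters in the generic shape
  set M : ℝ := (L : ℝ) ^ (k + 1) with hM
  set Dφ : ℝ := dirSq (coarseDatumNL L k Us U' u) (periodBox (d := 4) N) with hDφ
  set Lφ : ℝ := dirL1 (coarseDatumNL L k Us U' u) (periodBox (d := 4) N) with hLφ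
  have hDφ0 : 0 ≤ Dφ := by rw [hDφ]; unfold dirSq; positivity
  have hLφ0 : 0 ≤ Lφ := by rw [hLφ]; unfold dirL1; positivity
  set c₁ : ℝ := 2 * (l2C 4 L / (1 - thetaLoc 4 L * ε) ^ 2) + 2 * (16 * ((4 : ℕ) : ℝ) ^ 3 * ((64 : ℝ) ^ 4) ^ 2 * (CΘ₂ / (1 - thetaLoc 4 L * ε) ^ 2)) with hc₁
  set c₂ : ℝ := 2 * (curl2C 4 L / (1 - thetaLoc 4 L * ε) ^ 2) + 2 * (16 * P * ((64 : ℝ) ^ 4) ^ 2 * ε ^ 2 * (CΘ₂ / (1 - thetaLoc 4 L * ε) ^ 2)) with hc₂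
  set c₃ : ℝ := curl1C 4 L / (1 - thetaLoc 4 L * ε) + 4 * P * (64 : ℝ) ^ 4 * ε * (CΘ₁ / (1 - thetaLoc 4 L * ε)) with hc₃
  have hc₁0 : 0 ≤ c₁ := by positivity
  have hc₂0 : 0 ≤ c₂ := by positivity
  have hc₃0 : 0 ≤ c₃ := by positivity
  have hR1' : dirSq (rightInvW0 hL k hWu hx hsk hWx N hθ hE hφs) (periodBox (d := 4) (N * L ^ (k + 1))) ≤ c₁ * (M ^ 4 / M ^ 2) * Dφ := by
    refine hR1.trans (le_of_eq ?_)
    rw [hc₁, hCΘ₂]; ring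
  have hR2' : curlSq Us (rightInvW0 hL k hWu hx hsk hWx N hθ hE hφs) (periodBox (d := 4) (N * L ^ (k + 1))) ≤ c₂ * (M ^ 4 / M ^ 4) * Dφ := by
    refine hR2.trans (le_of_eq ?_)
    rw [hc₂, hCΘ₂, hP]; ring
  have hR3' : ∑ p ∈ perWin 4 (N * L ^ (k + 1)), ‖curl Us (rightInvW0 hL k hWu hx hsk hWx N hθ hE hφs) p‖ ≤ c₃ * (M ^ 4 / M ^ 2) * Lφ := by
    refine hR3.trans (le_of_eq ?_)
    rw [hc₃, hCΘ₁, hP]; ring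
  -- the direct letters in the generic shape
  set EX : ℝ := energyNormW L (k + 1) Us (repLog Us U' u) (periodBox (d := 4) (N * L ^ (k + 1))) with hEX
  have hq₂sq : 1024 * (C1cov 4 * (L : ℝ) ^ 2 * Real.sqrt (((4 : ℕ) : ℝ) * (2 * (2 * (L : ℝ)) + 1) ^ 4)) ^ 2 * ((L : ℝ) ^ 4 / (L : ℝ) ^ 4) * (M * (CS * ε / M)) ^ 2
      = (32 * K₁ * (CS * ε)) ^ 2 := by
    rw [hK₁]; field_simp; ring
  have hDL2' : M ^ 4 / M ^ 4 * Dφ ≤ (32 * K₁ * (CS * ε)) ^ 2 * EX ^ 2 := by rw [← hq₂sq]; exact hDL2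
  have hDL1' : M ^ 4 / M ^ 4 * Lφ ≤ q₁ * EX ^ 2 := by rw [hq₁]; exact hDL1
  -- the junction
  obtain ⟨u', X, XT, XN, α, ν, κ, hu', hXs', hXP', hα, hXα, hg', hXdec, hXT, hXN, hν, hN1, hN2, hαeq, hνeq, hκeq⟩ :=
    decomp_of_letters (d := 4) (L := L) (N := N) k hε (Us := Us) (U' := U')
      (fun j W => energyBlockLandauW (d := 4) (n := n) L N (j + 1) W) (fun Y hY => hY.1) (φ := coarseDatumNL L k Us U' u)
      (q₂ := 32 * K₁ * (CS * ε)) (q₁ := q₁) (c₁ := c₁) (c₂ := c₂) (c₃ := c₃) (by positivity) hc₁0 hc₂0 hc₃0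
      hu hgauge hXs hXP hbS hsup (hslice hWu hx hsk hWx hθ hE hφs) hR1' hR2' hR3' hDL2' hDL1'
  refine ⟨u', X, XT, XN, α, ν, κ, hu', hXs', hXP', hα, hXα, hg', hXdec, hXT, hXN, hν, hN1, hN2, ?_, ?_, ?_⟩
  · rw [hαeq]; exact le_of_eq (by field_simp)
  · -- `ν = √(c₁+c₂)·32K₁C_Sε ≤ √(A₁+A₂)·32K₁C_S·ε`
    rw [hνeq]
    have hε1' : ε ^ 2 ≤ 1 := by nlinarith only [hε.le, hε1]
    have hc₁le : c₁ ≤ A₁ := by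
      rw [hc₁, hA₁]
      have t1 : l2C 4 L / (1 - thetaLoc 4 L * ε) ^ 2 ≤ 4 * l2C 4 L := by
        rw [div_eq_mul_one_div]; nlinarith only [hinv2, hl2, mul_nonneg hl2 (show (0:ℝ) ≤ 1 / (1 - thetaLoc 4 L * ε) ^ 2 by positivity)]
      have t2 : CΘ₂ / (1 - thetaLoc 4 L * ε) ^ 2 ≤ 4 * CΘ₂ := by
        rw [div_eq_mul_one_div]; nlinarith only [hinv2, hCΘ₂0, mul_nonneg hCΘ₂0 (show (0:ℝ) ≤ 1 / (1 - thetaLoc 4 L * ε) ^ 2 by positivity)]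
      nlinarith only [t1, t2, hCΘ₂0]
    have hc₂le : c₂ ≤ A₂ := by
      rw [hc₂, hA₂]
      have t1 : curl2C 4 L / (1 - thetaLoc 4 L * ε) ^ 2 ≤ 4 * curl2C 4 L := by
        rw [div_eq_mul_one_div]; nlinarith only [hinv2, hc2, mul_nonneg hc2 (show (0:ℝ) ≤ 1 / (1 - thetaLoc 4 L * ε) ^ 2 by positivity)]
      have t2 : CΘ₂ / (1 - thetaLoc 4 L * ε) ^ 2 ≤ 4 * CΘ₂ := by
        rw [div_eq_mul_one_div]; nlinarith only [hinv2, hCΘ₂0, mul_nonneg hCΘ₂0 (show (0:ℝ) ≤ 1 / (1 - thetaLoc 4 L * ε) ^ 2 by positivity)]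
      have t3 : 16 * P * ((64 : ℝ) ^ 4) ^ 2 * ε ^ 2 * (CΘ₂ / (1 - thetaLoc 4 L * ε) ^ 2) ≤ 16 * P * ((64 : ℝ) ^ 4) ^ 2 * 1 * (4 * CΘ₂) := by
        have h0 : 0 ≤ CΘ₂ / (1 - thetaLoc 4 L * ε) ^ 2 := by positivity
        calc _ ≤ 16 * P * ((64 : ℝ) ^ 4) ^ 2 * 1 * (CΘ₂ / (1 - thetaLoc 4 L * ε) ^ 2) := by gcongr
          _ ≤ _ := by gcongr
      nlinarith only [t1, t3]
    have hsq : Real.sqrt (c₁ + c₂) ≤ Real.sqrt (A₁ + A₂) := Real.sqrt_le_sqrt (by linarith only [hc₁le, hc₂le])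
    have h0 : 0 ≤ 32 * K₁ * (CS * ε) := by positivity
    calc Real.sqrt (c₁ + c₂) * (32 * K₁ * (CS * ε)) ≤ Real.sqrt (A₁ + A₂) * (32 * K₁ * (CS * ε)) := mul_le_mul_of_nonneg_right hsq h0
      _ = Real.sqrt (A₁ + A₂) * (32 * K₁ * CS) * ε := by ring
  · -- `κ = ε·c₃·q₁ ≤ (A₃ q₁)·ε`
    rw [hκeq]
    have hc₃le : c₃ ≤ A₃ := by
      rw [hc₃, hA₃]
      have t1 : curl1C 4 L / (1 - thetaLoc 4 L * ε) ≤ 2 * curl1C 4 L := by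
        rw [div_eq_mul_one_div]; nlinarith only [hinv1, hc1, mul_nonneg hc1 hinv0]
      have t2 : CΘ₁ / (1 - thetaLoc 4 L * ε) ≤ 2 * CΘ₁ := by
        rw [div_eq_mul_one_div]; nlinarith only [hinv1, hCΘ₁0, mul_nonneg hCΘ₁0 hinv0]
      have t3 : 4 * P * (64 : ℝ) ^ 4 * ε * (CΘ₁ / (1 - thetaLoc 4 L * ε)) ≤ 4 * P * (64 : ℝ) ^ 4 * 1 * (2 * CΘ₁) := by
        have h0 : 0 ≤ CΘ₁ / (1 - thetaLoc 4 L * ε) := by positivity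
        calc _ ≤ 4 * P * (64 : ℝ) ^ 4 * 1 * (CΘ₁ / (1 - thetaLoc 4 L * ε)) := by gcongr
          _ ≤ _ := by gcongr
      nlinarith only [t1, t3]
    have h := mul_le_mul_of_nonneg_right hc₃le hq₁0
    calc ε * c₃ * q₁ = (c₃ * q₁) * ε := by ring
      _ ≤ (A₃ * q₁) * ε := mul_le_mul_of_nonneg_right h hε.le

end

end Summit.QuantumFields.BalabanUV.T4Continuum.NE7HdecompOfNL0Generic
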